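import Summits.QuantumFields.YangMills.Theorems.LuscherReductionTwistedTraceScalingMehlerGaussianFunctional
import HarnessLib

/-!
# C4 INNER, brick S (part 1b): the MEHLER (harmonic transfer) kernel has the Hermite functions as eigenfunctions, `K h_α = λ₀ r^α h_α`
# (lane A of S-BASE, crux `TwistedTraceScaling` stmt-QuantumFields-20203; sub-target C4, design note `pub/ym-fleet/ym-luscher-20007-p1/COARSE-DESIGN.md` §21.5 S;
# Folland 1989 §1.7, Wipf 2021 (8.58))

Source statements.  Wipf, *Statistical Approach to Quantum Field Theory* (LNP 992, 2021) §8.5.1, (8.54)–(8.58): the transfer "matrix" of the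
lattice harmonic oscillator is the Gaussian integral operator `K(x,y) = e^{−a x²} e^{−b(x−y)²} e^{−a y²}`; «`T̂` has a Gaussian eigenfunction» (8.56)
(tree: `Literature.Analysis.OperatorTheory.GaussianTransferKernel.integral_gaussKernel_mul_groundState`, ground state `e^{−c x²}`, `c² = a² + 2ab`,
top value `(π/s)^{1/2}`, `s = a + b + c`) and «all eigenvalues are `λ₀^{2n+1}`» (8.58), i.e. the spectrum is `λ₀ · rⁿ`, `r = b/s`, with the HERMITE
FUNCTIONS of width `c` as eigenfunctions — Mehler's formula / Folland, *Harmonic Analysis in Phase Space* (1989) §1.7 (the Hermite functions `h_α`,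
tree `Literature.Analysis.SegalBargmann.FockHermite`).

On `ℝ^σ` (`σ` finite) with per-coordinate parameters `a b : σ → ℝ`, normalised to the tree's Hermite width `c = π` by `a_k² + 2 a_k b_k = π²`
(`s_k := a_k + b_k + π > 0`, `r_k := b_k/s_k`), and `mehlerKernel a b x y = exp(−Σ_k [a_k x_k² + b_k (x_k − y_k)² + a_k y_k²])`:
* §3 the kernel on the Hermite span: `∫ K(x,y) (p γ)(y) dy = e^{−Σ(a_k+b_k)x_k²} · gintK s (2b•x) p` (`integral_mehlerKernel_hermiteFun`), the recursion
  ★ `mehler_opZs : I(Z_j^* p) = (2 − s_j/π)·I(X_j p) + (b_j/π) x_j·I(p)` (integration by parts, `gintK_div`) and the base ★ `mehler_vac : I(h_0) = λ₀ h_0`;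
* §4 ★★★ `mehler_herm : ∫ K(x,y) h_α(y) dy = (Π_k √(π/s_k)) · (Π_k (b_k/s_k)^{α_k}) · h_α(x)` for every multi-index `α` — by induction on `|α|` from the
  three-term recurrence (`opZs_herm`, `opZ_herm`) and the single algebraic identity `b_k² = s_k (a_k + b_k − π)` (⇔ `π² = a_k² + 2a_kb_k`, `mehler_key`).
Use (`Theorems/LuscherReductionTwistedTraceScalingInnerBOPackage`): the stiff-sector gap `θ = 1 − max_k r_k` of the Born–Oppenheimer package `InnerBOPackageAt` (with the
Hermite expansion of `Literature.Analysis.SegalBargmann.hermiteBasis`, next file: `⟨f,Kf⟩ ≤ λ₀[⟨f,ĥ₀⟩² + r_max(‖f‖² − ⟨f,ĥ₀⟩²)]`).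
HONEST FRAMING: classical one-body Gaussian analysis (Mehler 1866) for a stub of a child of the CONDITIONAL reduction route (femto rung R2b1); not infinite volume, not a gap, not Clay.

## References
* G. B. Folland, *Harmonic Analysis in Phase Space*, Princeton UP 1989, §1.7. [Folland1989]
* A. Wipf, *Statistical Approach to Quantum Field Theory*, LNP 992, Springer 2021, §8.5.1 (8.54)–(8.58). [Wipf2021]
-/

set_option autoImplicit false

open MvPolynomial Complex MeasureTheory
open scoped Real

namespace Summit.QuantumFields.YangMills.Theorems.FemtoTransferGap.Mehler

open Literature.Analysis.SegalBargmann

noncomputable section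

section NDim

variable {σ : Type*} [Fintype σ] [DecidableEq σ]

/-! ### §3 The Mehler kernel on the Hermite span -/

/-- **The Mehler / harmonic transfer kernel** on `ℝ^σ` with per-coordinate curvature `a_k` and kinetic constant `b_k`:
`K(x,y) = exp(−Σ_k [a_k x_k² + b_k (x_k − y_k)² + a_k y_k²])` (Wipf's (8.54) coordinatewise). [cite: Wipf2021, §8.5.1 (8.54)] -/
def mehlerKernel (a b : σ → ℝ) (x y : σ → ℝ) : ℝ := Real.exp (-∑ k, (a k * x k ^ 2 + b k * (x k - y k) ^ 2 + a k * y k ^ 2))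

omit [DecidableEq σ] in
/-- The kernel is positive. [folklore] -/
theorem mehlerKernel_pos (a b : σ → ℝ) (x y : σ → ℝ) : 0 < mehlerKernel a b x y := Real.exp_pos _

omit [DecidableEq σ] in
/-- The kernel is symmetric. [folklore] -/
theorem mehlerKernel_comm (a b : σ → ℝ) (x y : σ → ℝ) : mehlerKernel a b x y = mehlerKernel a b y x := by
  unfold mehlerKernel
  congr 1
  congr 1
  exact Finset.sum_congr rfl fun k _ => by ring

omit [DecidableEq σ] in
/-- Pointwise: `K(x,y) · (p γ)(y) = e^{−Σ(a_k+b_k)x_k²} · p(y) · Π_k e^{−s_k y_k² + 2 b_k x_k y_k}`, `s_k = a_k + b_k + π` (the kernel times the Hermite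
weight `γ = e^{−π|y|²}` is a shifted Gaussian weight of width `s_k`). [cite: Wipf2021, §8.5.1 (8.56)] -/
theorem mehlerKernel_mul_hermiteFun (a b : σ → ℝ) (p : MvPolynomial σ ℂ) (x y : σ → ℝ) :
    (mehlerKernel a b x y : ℂ) * hermiteFun p y =
      cexp (-∑ k, ((a k + b k : ℝ) : ℂ) * (x k : ℂ) ^ 2) *
        (eval (fun k => (y k : ℂ)) p * kweight (fun k => a k + b k + π) (fun k => 2 * b k * x k) y) := by
  have hker : (mehlerKernel a b x y : ℂ) * gauss y =
      cexp (-∑ k, ((a k + b k : ℝ) : ℂ) * (x k : ℂ) ^ 2) * kweight (fun k => a k + b k + π) (fun k => 2 * b k * x k) y := by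
    rw [mehlerKernel, Complex.ofReal_exp, gauss, kweight, ← Complex.exp_sum, ← Complex.exp_add, ← Complex.exp_add]
    congr 1
    push_cast
    rw [Finset.mul_sum, ← Finset.sum_neg_distrib, ← Finset.sum_neg_distrib, ← Finset.sum_add_distrib, ← Finset.sum_add_distrib]
    exact Finset.sum_congr rfl fun k _ => by ring
  rw [hermiteFun, mul_left_comm, hker]
  ring

omit [DecidableEq σ] in
/-- ★ **The kernel on the Hermite span is the weighted Gaussian functional**:
`∫ K(x,y) (p γ)(y) dy = e^{−Σ(a_k+b_k)x_k²} · gintK s (2b•x) p`. [cite: Wipf2021, §8.5.1 (8.56)] -/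
theorem integral_mehlerKernel_hermiteFun {a b : σ → ℝ} (hs : ∀ k, 0 < a k + b k + π) (p : MvPolynomial σ ℂ) (x : σ → ℝ) :
    ∫ y, (mehlerKernel a b x y : ℂ) * hermiteFun p y =
      cexp (-∑ k, ((a k + b k : ℝ) : ℂ) * (x k : ℂ) ^ 2) * gintK hs (fun k => 2 * b k * x k) p := by
  simp_rw [mehlerKernel_mul_hermiteFun]
  rw [integral_const_mul, gintK_apply]

/-- The recursion on symbols: `gintK(Z_j^* p) = (2 − s_j/π)·gintK(X_j p) + (κ_j/(2π))·gintK p`. [cite: Folland1989, §1.7 (1.82)] -/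
theorem gintK_opZs {s : σ → ℝ} (hs : ∀ k, 0 < s k) (κ : σ → ℝ) (j : σ) (p : MvPolynomial σ ℂ) :
    gintK hs κ (opZs j p) = (2 - (s j : ℂ) / π) * gintK hs κ (X j * p) + ((κ j : ℂ) / (2 * π)) * gintK hs κ p := by
  rw [opZs_apply, map_sub, map_smul, map_smul, gintK_div hs κ j p, smul_eq_mul, smul_eq_mul]
  have hπ : (π : ℂ) ≠ 0 := Complex.ofReal_ne_zero.mpr Real.pi_ne_zero
  field_simp
  ring

/-- ★ **The Mehler recursion**: with `I(p)(x) = ∫ K(x,y)(pγ)(y) dy`,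
`I(Z_j^* p) = (2 − s_j/π)·I(X_j p) + (b_j/π)·x_j·I(p)`, `s_j = a_j + b_j + π`. [cite: Folland1989, §1.7 (1.82)] -/
theorem mehler_opZs {a b : σ → ℝ} (hs : ∀ k, 0 < a k + b k + π) (j : σ) (p : MvPolynomial σ ℂ) (x : σ → ℝ) :
    ∫ y, (mehlerKernel a b x y : ℂ) * hermiteFun (opZs j p) y =
      (2 - ((a j + b j + π : ℝ) : ℂ) / π) * (∫ y, (mehlerKernel a b x y : ℂ) * hermiteFun (X j * p) y) +
        (((b j : ℝ) : ℂ) / π) * (x j : ℂ) * ∫ y, (mehlerKernel a b x y : ℂ) * hermiteFun p y := by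
  rw [integral_mehlerKernel_hermiteFun hs, integral_mehlerKernel_hermiteFun hs, integral_mehlerKernel_hermiteFun hs, gintK_opZs]
  have hπ : (π : ℂ) ≠ 0 := Complex.ofReal_ne_zero.mpr Real.pi_ne_zero
  push_cast
  field_simp

omit [DecidableEq σ] in
/-- The one algebraic identity: `π² = a² + 2ab` ⇔ `b² = s(a + b − π)`, `s = a + b + π`. [cite: Wipf2021, §8.5.1 (8.57)] -/
theorem mehler_key {a b : ℝ} (hab : a ^ 2 + 2 * a * b = π ^ 2) : b ^ 2 = (a + b + π) * (a + b - π) := by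
  nlinarith [hab]

omit [DecidableEq σ] in
/-- ★ **Base: the Gaussian ground state** `I(h_0) = λ₀ · h_0`, `λ₀ = Π_k √(π/s_k)` (`h_0 = 2^{n/4} e^{−π|x|²}`). [cite: Wipf2021, §8.5.1 (8.56)–(8.57)] -/
theorem mehler_vac {a b : σ → ℝ} (hs : ∀ k, 0 < a k + b k + π) (hab : ∀ k, a k ^ 2 + 2 * a k * b k = π ^ 2) (x : σ → ℝ) :
    ∫ y, (mehlerKernel a b x y : ℂ) * hermiteFun (vac σ) y =
      ((∏ k, Real.sqrt (π / (a k + b k + π)) : ℝ) : ℂ) * hermiteFun (vac σ) x := by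
  rw [integral_mehlerKernel_hermiteFun hs, vac, show C (vacCoef σ : ℂ) = (vacCoef σ : ℂ) • (1 : MvPolynomial σ ℂ) by
    rw [Algebra.smul_def, mul_one]; rfl, map_smul, gintK_one, hermiteFun_smul, smul_eq_mul]
  have h1 : hermiteFun (1 : MvPolynomial σ ℂ) x = gauss x := by simp [hermiteFun]
  rw [h1, gauss]
  -- collect the exponentials coordinatewise
  have hprod : (∏ k, (((Real.sqrt (π / (a k + b k + π)) * Real.exp ((2 * b k * x k) ^ 2 / (4 * (a k + b k + π))) : ℝ)) : ℂ)) =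
      ((∏ k, Real.sqrt (π / (a k + b k + π)) : ℝ) : ℂ) * cexp (∑ k, (((b k ^ 2 / (a k + b k + π)) : ℝ) : ℂ) * (x k : ℂ) ^ 2) := by
    push_cast
    rw [Complex.exp_sum, ← Finset.prod_mul_distrib]
    refine Finset.prod_congr rfl fun k _ => ?_
    congr 2
    have hsk : ((a k : ℂ) + b k + π) ≠ 0 := by exact_mod_cast (hs k).ne'
    field_simp
    ring
  have hexp : cexp (-∑ k, ((a k + b k : ℝ) : ℂ) * (x k : ℂ) ^ 2) * cexp (∑ k, (((b k ^ 2 / (a k + b k + π)) : ℝ) : ℂ) * (x k : ℂ) ^ 2) =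
      cexp (-(π : ℂ) * ∑ k, (x k : ℂ) ^ 2) := by
    rw [← Complex.exp_add]
    congr 1
    rw [Finset.mul_sum, ← Finset.sum_neg_distrib, ← Finset.sum_add_distrib]
    refine Finset.sum_congr rfl fun k _ => ?_
    have hsk : (a k + b k + π : ℝ) ≠ 0 := (hs k).ne'
    have hkey := mehler_key (hab k)
    have hcoef : -(a k + b k) + b k ^ 2 / (a k + b k + π) = -π := by
      rw [hkey]; field_simp; ring
    have hc : -(((a k + b k : ℝ) : ℂ)) + (((b k ^ 2 / (a k + b k + π) : ℝ)) : ℂ) = -(π : ℂ) := by exact_mod_cast hcoef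
    linear_combination ((x k : ℂ)) ^ 2 * hc
  rw [hprod]
  calc cexp (-∑ k, ((a k + b k : ℝ) : ℂ) * (x k : ℂ) ^ 2) *
        ((vacCoef σ : ℂ) * (((∏ k, Real.sqrt (π / (a k + b k + π)) : ℝ) : ℂ) * cexp (∑ k, (((b k ^ 2 / (a k + b k + π)) : ℝ) : ℂ) * (x k : ℂ) ^ 2)))
      = (vacCoef σ : ℂ) * (((∏ k, Real.sqrt (π / (a k + b k + π)) : ℝ) : ℂ)) *
          (cexp (-∑ k, ((a k + b k : ℝ) : ℂ) * (x k : ℂ) ^ 2) * cexp (∑ k, (((b k ^ 2 / (a k + b k + π)) : ℝ) : ℂ) * (x k : ℂ) ^ 2)) := by ring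
    _ = (((∏ k, Real.sqrt (π / (a k + b k + π)) : ℝ) : ℂ)) * ((vacCoef σ : ℂ) * cexp (-(π : ℂ) * ∑ k, (x k : ℂ) ^ 2)) := by rw [hexp]; ring

/-! ### §4 ★★★ The Hermite functions are eigenfunctions: `K h_α = λ₀ r^α h_α` -/

omit [Fintype σ] [DecidableEq σ] in
/-- `X_j p = ½ (Z_j^* p + Z_j p)` on symbols (`Z^* = 2X − (2π)⁻¹∂`, `Z = (2π)⁻¹∂`). [cite: Folland1989, §1.7] -/
theorem X_mul_eq_half_opZs_add_opZ [Fintype σ] [DecidableEq σ] (j : σ) (p : MvPolynomial σ ℂ) :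
    X j * p = (2 : ℂ)⁻¹ • (opZs j p + opZ j p) := by
  rw [opZs_apply, opZ_apply, sub_add_cancel, smul_smul, inv_mul_cancel₀ two_ne_zero, one_smul]

/-- The `r`-powers along a multi-index step: `Π_k r_k^{(γ + 1_j)_k} = r_j · Π_k r_k^{γ_k}`. [folklore] -/
theorem prod_pow_add_single (r : σ → ℝ) (γ : σ →₀ ℕ) (j : σ) :
    ∏ k, r k ^ ((γ + Finsupp.single j 1 : σ →₀ ℕ) k) = r j * ∏ k, r k ^ (γ k) := by
  rw [← Finset.mul_prod_erase _ _ (Finset.mem_univ j), ← Finset.mul_prod_erase Finset.univ (fun k => r k ^ (γ k)) (Finset.mem_univ j)]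
  rw [Finsupp.add_apply, Finsupp.single_eq_same, pow_succ]
  have h : ∏ k ∈ Finset.univ.erase j, r k ^ ((γ + Finsupp.single j 1 : σ →₀ ℕ) k) = ∏ k ∈ Finset.univ.erase j, r k ^ (γ k) :=
    Finset.prod_congr rfl fun k hk => by
      rw [Finsupp.add_apply, Finsupp.single_apply, if_neg (Finset.ne_of_mem_erase hk).symm, add_zero]
  rw [h]
  ring

/-- ★★★ **MEHLER'S EIGENFUNCTIONS.**  For `0 < a_k + b_k + π` and `a_k² + 2a_kb_k = π²` (the tree's Hermite width `c = π`), every Hermite function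
`h_α = hermiteFun (herm α)` is an eigenfunction of the Mehler kernel:
`∫ K(x,y) h_α(y) dy = (Π_k √(π/s_k)) · (Π_k (b_k/s_k)^{α_k}) · h_α(x)`, `s_k = a_k + b_k + π`. [cite: Wipf2021, §8.5.1 (8.58)] [cite: Folland1989, §1.7] -/
theorem mehler_herm {a b : σ → ℝ} (hs : ∀ k, 0 < a k + b k + π) (hab : ∀ k, a k ^ 2 + 2 * a k * b k = π ^ 2) (α : σ →₀ ℕ) (x : σ → ℝ) :
    ∫ y, (mehlerKernel a b x y : ℂ) * hermiteFun (herm α) y =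
      (((∏ k, Real.sqrt (π / (a k + b k + π))) * ∏ k, (b k / (a k + b k + π)) ^ (α k) : ℝ) : ℂ) * hermiteFun (herm α) x := by
  -- strong induction on the degree
  suffices h : ∀ (n : ℕ) (α : σ →₀ ℕ), mdeg α ≤ n → ∀ x : σ → ℝ, ∫ y, (mehlerKernel a b x y : ℂ) * hermiteFun (herm α) y =
      (((∏ k, Real.sqrt (π / (a k + b k + π))) * ∏ k, (b k / (a k + b k + π)) ^ (α k) : ℝ) : ℂ) * hermiteFun (herm α) x from h _ α le_rfl x
  intro n
  induction n with
  | zero =>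
      intro α hα x
      have h0 : α = 0 := (mdeg_eq_zero_iff α).mp (Nat.le_zero.mp hα)
      subst h0
      rw [herm_zero, mehler_vac hs hab]
      simp
  | succ n ih =>
      intro α hα x
      by_cases hle : mdeg α ≤ n
      · exact ih α hle x
      have hαn : mdeg α = n + 1 := by omega
      obtain ⟨j, hj⟩ : ∃ j, α j ≠ 0 := by
        by_contra hcon
        push Not at hcon
        have h0 : α = 0 := Finsupp.ext hcon
        rw [h0, (mdeg_eq_zero_iff (0 : σ →₀ ℕ)).mpr rfl] at hαn
        exact Nat.succ_ne_zero n hαn.symm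
      set γ : σ →₀ ℕ := α - Finsupp.single j 1 with hγdef
      have hαeq : γ + Finsupp.single j 1 = α := Finsupp.sub_add_single_one_cancel hj
      have hdeg : mdeg γ = n := by
        have h := mdeg_add_single γ j
        rw [hαeq, hαn] at h
        omega
      -- abbreviations
      set L : ℝ := ∏ k, Real.sqrt (π / (a k + b k + π)) with hL
      set r : σ → ℝ := fun k => b k / (a k + b k + π) with hr
      set c : ℝ := Real.sqrt ((γ j + 1) / π) with hc
      set c' : ℝ := Real.sqrt (γ j / π) with hc'
      have hcpos : 0 < c := Real.sqrt_pos.mpr (by positivity)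
      have hcne : (c : ℂ) ≠ 0 := Complex.ofReal_ne_zero.mpr hcpos.ne'
      have hsj : (a j + b j + π : ℝ) ≠ 0 := (hs j).ne'
      have hπ : (π : ℂ) ≠ 0 := Complex.ofReal_ne_zero.mpr Real.pi_ne_zero
      -- the ladder: `herm α = c⁻¹ • Z_j^* herm γ`, `X_j herm γ = ½ (c • herm α + c' • herm(γ − 1_j))`
      have hs1 : opZs j (herm γ) = (c : ℂ) • herm α := by rw [opZs_herm, hαeq]
      have hs2 : opZ j (herm γ) = (c' : ℂ) • herm (γ - Finsupp.single j 1) := opZ_herm j γ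
      have hX : X j * herm γ = (2 : ℂ)⁻¹ • ((c : ℂ) • herm α + (c' : ℂ) • herm (γ - Finsupp.single j 1)) := by
        rw [X_mul_eq_half_opZs_add_opZ, hs1, hs2]
      -- everything through the linear functional `G = gintK s (2b•x)`
      set E : ℂ := cexp (-∑ k, ((a k + b k : ℝ) : ℂ) * (x k : ℂ) ^ 2) with hE
      set G := gintK hs (fun k => 2 * b k * x k) with hG
      have hI : ∀ p : MvPolynomial σ ℂ, ∫ y, (mehlerKernel a b x y : ℂ) * hermiteFun p y = E * G p :=
        fun p => integral_mehlerKernel_hermiteFun hs p x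
      -- the induction hypotheses, as statements about `E * G(·)`
      have ihγ : E * G (herm γ) = (((L * ∏ k, r k ^ (γ k)) : ℝ) : ℂ) * hermiteFun (herm γ) x := by
        rw [← hI]; exact ih γ hdeg.le x
      have ihγ' : E * G (herm (γ - Finsupp.single j 1)) =
          (((L * ∏ k, r k ^ ((γ - Finsupp.single j 1 : σ →₀ ℕ) k)) : ℝ) : ℂ) * hermiteFun (herm (γ - Finsupp.single j 1)) x := by
        rw [← hI]; exact ih _ ((mdeg_tsub_le γ j).trans hdeg.le) x
      -- the recursion (★) at `p = herm γ`, denominators cleared: `2π c G(h_α) = (2π − s_j)(c G(h_α) + c' G(h_{γ−1_j})) + 2 b_j x_j G(h_γ)`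
      have hstar : 2 * (π : ℂ) * ((c : ℂ) * G (herm α)) =
          (2 * π - ((a j + b j + π : ℝ) : ℂ)) * ((c : ℂ) * G (herm α) + (c' : ℂ) * G (herm (γ - Finsupp.single j 1))) +
            2 * (b j : ℂ) * (x j : ℂ) * G (herm γ) := by
        have h := gintK_opZs hs (fun k => 2 * b k * x k) j (herm γ)
        rw [← hG, hs1, hX] at h
        simp only [map_smul, map_add, smul_eq_mul] at h
        have h' := congrArg (fun z => 2 * (π : ℂ) * z) h
        rw [h']
        push_cast
        field_simp
      -- the three-term recurrence on the `x` side: `c h_α(x) = 2 x_j h_γ(x) − c' h_{γ−1_j}(x)`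
      have hxx : (c : ℂ) * hermiteFun (herm α) x = 2 * (x j : ℂ) * hermiteFun (herm γ) x - (c' : ℂ) * hermiteFun (herm (γ - Finsupp.single j 1)) x := by
        have h := congrArg (fun q => hermiteFun q x) hX
        simp only [hermiteFun_X_mul, hermiteFun_smul, hermiteFun_add] at h
        linear_combination (-2 : ℂ) * h
      -- the weights: `Λ_α = r_j Λ_γ`
      have hΛα : ((L * ∏ k, (b k / (a k + b k + π)) ^ (α k) : ℝ) : ℂ) = ((r j : ℝ) : ℂ) * (((L * ∏ k, r k ^ (γ k)) : ℝ) : ℂ) := by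
        rw [← hαeq, show (fun k => (b k / (a k + b k + π)) ^ ((γ + Finsupp.single j 1 : σ →₀ ℕ) k)) = fun k => r k ^ ((γ + Finsupp.single j 1 : σ →₀ ℕ) k)
          from rfl, prod_pow_add_single]
        push_cast
        ring
      -- the scalar identities: `r_j s_j = b_j`, `r_j² s_j = s_j − 2π` (⇔ `b² = s(a+b−π)`)
      have hsC : ((a j + b j + π : ℝ) : ℂ) ≠ 0 := by exact_mod_cast hsj
      have hrj : ((r j : ℝ) : ℂ) * ((a j + b j + π : ℝ) : ℂ) = (b j : ℂ) := by
        have hsC' : (a j : ℂ) + b j + π ≠ 0 := by exact_mod_cast hsj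
        rw [hr]; push_cast; field_simp
      have hr2 : ((r j : ℝ) : ℂ) ^ 2 * ((a j + b j + π : ℝ) : ℂ) = ((a j + b j + π : ℝ) : ℂ) - 2 * π := by
        have hkeyC : ((b j : ℝ) : ℂ) ^ 2 = ((a j + b j + π : ℝ) : ℂ) * ((a j + b j - π : ℝ) : ℂ) := by exact_mod_cast mehler_key (hab j)
        apply mul_left_cancel₀ hsC
        have e : ((a j + b j - π : ℝ) : ℂ) = ((a j + b j + π : ℝ) : ℂ) - 2 * π := by push_cast; ring
        rw [e] at hkeyC
        linear_combination (((r j : ℝ) : ℂ) * ((a j + b j + π : ℝ) : ℂ) + (b j : ℂ)) * hrj + hkeyC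
      -- cancel `c · s_j` and conclude
      have hcs : (c : ℂ) * ((a j + b j + π : ℝ) : ℂ) ≠ 0 := mul_ne_zero hcne hsC
      rw [hI]
      apply mul_left_cancel₀ hcs
      -- `c s E G(h_α) = (2π − s) c' E G(h_{γ−1_j}) + 2 b x_j E G(h_γ)` (from ★)
      have h1 : (c : ℂ) * ((a j + b j + π : ℝ) : ℂ) * (E * G (herm α)) =
          (2 * π - ((a j + b j + π : ℝ) : ℂ)) * (c' : ℂ) * (E * G (herm (γ - Finsupp.single j 1))) + 2 * (b j : ℂ) * (x j : ℂ) * (E * G (herm γ)) := by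
        linear_combination E * hstar
      by_cases hγj : γ j = 0
      · -- then `c' = 0`
        have hc'0 : (c' : ℂ) = 0 := by rw [hc', hγj]; simp
        rw [hc'0, mul_zero, zero_mul, zero_add] at h1
        rw [hc'0, zero_mul, sub_zero] at hxx
        rw [h1, ihγ, hΛα]
        linear_combination (-(((a j + b j + π : ℝ) : ℂ) * ((r j : ℝ) : ℂ) * (((L * ∏ k, r k ^ (γ k)) : ℝ) : ℂ))) * hxx
          - (2 * (x j : ℂ) * (((L * ∏ k, r k ^ (γ k)) : ℝ) : ℂ) * hermiteFun (herm γ) x) * hrj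
      · have hγeq : (γ - Finsupp.single j 1) + Finsupp.single j 1 = γ := Finsupp.sub_add_single_one_cancel hγj
        set Λ' : ℂ := (((L * ∏ k, r k ^ ((γ - Finsupp.single j 1 : σ →₀ ℕ) k)) : ℝ) : ℂ) with hΛ'
        have hΛγ : (((L * ∏ k, r k ^ (γ k)) : ℝ) : ℂ) = ((r j : ℝ) : ℂ) * Λ' := by
          rw [hΛ']
          conv_lhs => rw [← hγeq]
          rw [prod_pow_add_single]
          push_cast
          ring
        rw [h1, ihγ, ihγ', hΛα, hΛγ]
        linear_combination (-(((a j + b j + π : ℝ) : ℂ) * ((r j : ℝ) : ℂ) ^ 2 * Λ')) * hxx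
          - (2 * (x j : ℂ) * Λ' * hermiteFun (herm γ) x * ((r j : ℝ) : ℂ)) * hrj
          + ((c' : ℂ) * Λ' * hermiteFun (herm (γ - Finsupp.single j 1)) x) * hr2

end NDim

end

end Summit.QuantumFields.YangMills.Theorems.FemtoTransferGap.Mehler
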